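/-
Copyright (c) 2026. All rights reserved.
Released under Apache 2.0 license as described in the file LICENSE.
-/
import Literature.NumberTheory.Automorphic.MaximalOrderDiscFiveClassNumberOne
import Literature.NumberTheory.Automorphic.MaximalOrderDiscFiveNormsFiveMul
import Literature.NumberTheory.Automorphic.MaximalOrderDiscFiveNormsSmall
import Literature.NumberTheory.Automorphic.BrandtModuleLevelOneTwo
import Literature.NumberTheory.Automorphic.BrandtMatrixRamified
import Literature.NumberTheory.Automorphic.EichlerSubidealCount
import Literature.NumberTheory.Automorphic.BrandtMultiplicativityHolds
import HarnessLib

/-!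
# The Brandt setups of type `(N⁺, N⁻) = (1, 5)`: `h = 1`, `w = 3`, `Σ 1/w = 1/3` (Eichler's mass formula), `T(p) = (p + 1)`
# for primes `p ≠ 5`, `T(5ᵃ) = (1)` — for EVERY setup / Eichler package of that type and for `brandtModule 1 5`; and the
# representation numbers of `a² + 2b² + 2c² + d² + ac − ad + 2bc + bd`: `r₅(p) = 6(p + 1)` (`p ≠ 5`), `r₅(5ᵃm) = 6σ(m)`
# (`m` squarefree, `5 ∤ m`), `r₅(9) = 78`, `r₅(16) = 186`, and Eichler's recursion at `p = 2, 3`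

[tag: quaternion_algebra] [tag: brandt_matrix] [tag: class_number] [tag: mass_formula]

Topic `NumberTheory/Automorphic`; THEOREMS ONLY (no definition, no named fact, no instance; net Literature debt `0`).
Lane `lit-hodgefound`, seat p12, gen 46 — eighth file of the series on the definite quaternion order of (reduced) discriminant `5`
(`MaximalOrderDiscFiveLattice`: `O₅ = ℤ⟨1, i, (1+i+j)/2, (−2+i+k)/4⟩ ⊂ (−2,−5 ∣ ℚ)` maximal, `#O₅^× = 6`, `w(O₅) = 3`;
`…Ramification`: `Ram_f = {5}`, totally definite; `…ClassNumberOne`: `# Cls O₅ = 1` (the order is norm-Euclidean,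
`…Euclidean`); `…NormsFiveMul`: `r₅(5ᵃn) = r₅(n)`; `…NormsSmall`: `r₅(n)` for `n ≤ 8` by certified enumeration). It is the `D = 5`
twin of `MaximalOrderDiscThreeBrandtSetup`: it assembles the Brandt SETUP `(ℍ[ℚ,−2,−5], O₅) : Brandt.XiSetup 1 5` (a structure value,
built inside the proofs) and transports its data to every abstract object of type `(1, 5)` of the tree — the algebra of a setup of
type `(1, 5)` is isomorphic to `(−2,−5)_ℚ` (same ramification, Vignéras III §3 Thm. 3.1 = the tree's
`nonempty_algEquiv_of_ramifiedPlaces_eq_holds`), its Eichler order is tied to the image of `O₅` by a connecting ideal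
(`IsEichlerOrder.exists_isInvertibleRightIdeal_leftOrderOf_eq`), and class sets, weights and Brandt matrices correspond
(`exists_classSetEquiv_map_ringEquiv`, `exists_classSetEquiv_leftOrder`):

* §1 (at `O₅`) `matrix_prime` (**`T(p)_ij = p + 1` for primes `p ≠ 5`** — Eichler's column sum `p + 1` at a good prime,
  `XiSetup.sum_matrix_prime_eq`, on the one-point class set), **`natCard_reducedNorm_eq_six_mul_matrix`**
  (`#{x ∈ O₅ : nrd x = n} = 2w·T(n)_ii = 6·T(n)_ii`), **`matrix_five_pow`** (`T(5ᵃ)_ij = 1` FOR EVERY `a` — read off the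
  elementary count `#{x ∈ O₅ : nrd x = 5ᵃ} = 6` of `…NormsFiveMul`), `matrix_five`, `matrix_five_mul_self` (`T(5)² = 1`,
  Eichler (20)), `matrix_one'`, `matrix_mul_of_coprime'`, `matrix_apply_mul_of_coprime`; **`natCard_reducedNorm_prime`**
  (`#{x ∈ O₅ : nrd x = p} = 6(p + 1)` for primes `p ≠ 5`) and, in the coordinates of `O₅`, **`natCard_form_prime`**: THE NUMBER
  OF `(a,b,c,d) ∈ ℤ⁴` WITH `a² + 2b² + 2c² + d² + ac − ad + 2bc + bd = p` IS `6(p + 1)` FOR EVERY PRIME `p ≠ 5` (Eichler's Cor. 1: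
  the row sums of `B(n)` are `Σ_{d ∣ n, 5 ∤ d} d`; here by the class-number-one ∕ Hecke route); by multiplicativity
  **`matrix_apply_of_squarefree`** (`T(n)_ij = σ(n)`, `n` squarefree, `5 ∤ n`), **`matrix_apply_five_pow_mul`**
  (`T(5ᵃm)_ij = T(m)_ij`, `5 ∤ m`), `matrix_apply_five_pow_mul_of_squarefree`, **`natCard_form_of_squarefree`**
  (`r₅(n) = 6σ(n)` for squarefree `n` prime to `5`) and **`natCard_form_five_pow_mul_of_squarefree`** (`r₅(5ᵃm) = 6σ(m)`);
  the first non-squarefree values `matrix_two` (`3`), `matrix_three` (`4`), **`matrix_four`** (`7`), **`matrix_eight`** (`15`),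
  **`matrix_nine`** (`13`), **`matrix_sixteen`** (`31`) from the certified counts `r₅(4) = 42`, `r₅(8) = 90` (`…NormsSmall`) and
  **`natCard_form_nine`** (`r₅(9) = 78`), **`natCard_form_sixteen`** (`r₅(16) = 186`) proved here, with the instances
  **`matrix_two_mul_matrix_two`** (`B(2)² = B(4) + 2`), **`matrix_two_mul_matrix_four`** (`B(2)B(4) = B(8) + 2B(2)`),
  **`matrix_two_mul_matrix_eight`** (`B(2)B(8) = B(16) + 2B(4)`), **`matrix_three_mul_matrix_three`** (`B(3)² = B(9) + 3`) of
  EICHLER'S RECURSION (19) `B(p)B(p^ν) = B(p^{ν+1}) + pB(p^{ν−1})` at the split primes `2, 3`;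
* §2 (every `S : XiSetup 1 5`) `xiSetup_nonempty_algEquiv` (`S.D ≃ₐ[ℚ] ℍ[ℚ,−2,−5]`: THE definite quaternion algebra of
  discriminant `5`), **`xiSetup_natCard_classSet`** (`# Cls S.O = 1` — VOIGHT THM. 25.4.1 AT `D = 5`), `xiSetup_subsingleton_classSet`,
  `xiSetup_card_classSet`, **`xiSetup_weight`** (`w_c = 3`), **`xiSetup_sum_inv_weight`** (`Σ_c 1/w_c = 1/3 = φ(5)/12` — EICHLER'S
  MASS FORMULA AT `(D, N) = (5, 1)`, Voight Thm. 25.1.1), `xiSetup_matrix_prime`, `xiSetup_matrix_five_pow`, `xiSetup_matrix_five`,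
  `xiSetup_matrix_one`, `xiSetup_matrix_apply_of_squarefree`;
* §3 (every `P : EichlerPackage 1 5`) `eichlerPackage_natCard_ι`, **`eichlerPackage_classNumber`** (`h = 1`), `eichlerPackage_w`
  (`w_i = 3`), `eichlerPackage_sum_inv_w`, **`eichlerPackage_massFormula`** — THE LEVEL-`(1, 5)` CLAUSE OF THE NAMED FACT
  `brandtModule_massFormula`, UNCONDITIONALLY (`Σ_i 1/w_i = (1/12)·∏_{q∣5}(q − 1)·∏_{p∣1}(…) = 4/12 = 1/3`), `eichlerPackage_T_prime`,
  `eichlerPackage_T_five_pow`, `eichlerPackage_T_five`;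
* §4 (the chosen data) `nonempty_eichlerPackage_one_five` (an explicit package `(ℍ[ℚ,−2,−5], O₅)`),
  **`brandtModule_one_five_classNumber`** (`= 1`), **`brandtModule_one_five_w`** (`= 3`), `brandtModule_one_five_sum_inv_w`
  (`= 1/3`), `brandtModule_one_five_T_prime`, `brandtModule_one_five_T_five_pow`.

The values `T(pᵃ)` for `a ≥ 2`, `p ≠ 5` in general (Hecke recursion) are deferred to a sequel; here only `p^a ∈ {4, 8, 9, 16}`.

## Sources

* J. Voight, *Quaternion Algebras*, GTM 288 (2021): Thm. 25.4.1 («`# Cls O = 1` if and only if `D = 2, 3, 5, 7, 13`» — here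
  `D = 5`, direction ⇐), Exercise 17.10 ((a) «Show that `# Cls O = 1`» for discriminant `5`; (b) the norm form is multiplicative),
  Thm. 25.1.1 (Eichler mass formula over `ℚ`: `Σ_{[J] ∈ Cls O} 1/w_J = φ(D)/12`, `w_J = #O_L(J)^×/{±1}`), Thm. 11.5.14 (unit groups
  of definite orders), Exercise 11.14 (c) (number of right ideals of reduced norm `p` is `p + 1`), 41.1.3 (weights), Lemma 41.2.7.
  [cite: Voight2021, Thm. 25.4.1 (D = 5); Exercise 17.10; Thm. 25.1.1; Thm. 11.5.14; Exercise 11.14 (c); Lemma 41.2.7]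
* M.-F. Vignéras, *Arithmétique des algèbres de quaternions*, LNM 800 (1980): Ch. III §3 Thm. 3.1 (classification by
  ramification), Ch. III §5 Cor. 5.5 and §5 B (Eichler orders of the same level are tied by an ideal), exercice 5.8
  (Brandt matrices), Ch. V §2 Cor. 2.3 (formule de masse: `(1/12)∏_{p∣D}(p − 1) = 4/12`). [cite: VignerasLNM800, Ch. III §3 Thm. 3.1; Ch. III §5 Cor. 5.5, §5 B, exercice 5.8; Ch. V §2 Cor. 2.3]
* M. Eichler, LNM 320 (1973), Ch. II §6 (16), Thm. 2 (18)–(20) and Cor. 1 (column sums `p + 1`; `B(p)` at `p ∣ D`; the recursion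
  (19) `B(p^μ)B(p^ν) = Σ_σ p^σ B(p^{μ+ν−2σ})`; row sums). [cite: Eichler1973, Ch. II §6 (16), Thm. 2 (18)–(20) and Cor. 1]
* A. Pizer, *An algorithm for computing modular forms on Γ₀(N)*, J. Algebra 64 (1980), §2. [cite: Pizer1980, §2]

## Scope (honest)

Theorems only — no definition, no named fact, no instance. Level `(1, 5)` only. Brandt matrices and representation numbers in
closed form only when the `5`-free part of the argument is squarefree, plus `4, 8, 9, 16` by certified enumeration; general prime
powers `pᵃ` (`p ≠ 5`, `a ≥ 2`) await the Hecke recursion (`BrandtHeckeFamily`).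
-/

open Quaternion
open Finset
open scoped Pointwise
open Literature.NumberTheory.Automorphic.Brandt

namespace Literature.NumberTheory.Automorphic.MaxOrderDiscFive

/-! ## §1 The setup `(ℍ[ℚ,−2,−5], O₅)`: `T(p)`, `T(5ᵃ)`, and the representation numbers `r₅` -/

section AtO

/-- The class set of `O₅` is finite (a point). [folklore] -/
private theorem finite_classSet₅ : Finite (ClassSet (Submodule.span ℤ (Set.range ![(⟨1, 0, 0, 0⟩ : ℍ[ℚ,-2,-5]), ⟨0, 1, 0, 0⟩, ⟨1/2, 1/2, 1/2, 0⟩, ⟨-1/2, 1/4, 0, 1/4⟩]))) :=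
  haveI := isQuaternionAlgebra
  Brandt.finite_classSet ℚ isOrder_lattice

/-- The facts about `O₅` read off the Brandt setup `(ℍ[ℚ,−2,−5], O₅) : XiSetup 1 5` (a structure VALUE): Eichler's column
sums `p + 1` at `p ≠ 5`, `T(5)² = 1`, multiplicativity, and `2w_i T(n)_ii = #{x ∈ O_L(I_i) : nrd x = n}`. [folklore] -/
private theorem setup_facts :
    (∀ [Fintype (ClassSet (Submodule.span ℤ (Set.range ![(⟨1, 0, 0, 0⟩ : ℍ[ℚ,-2,-5]), ⟨0, 1, 0, 0⟩, ⟨1/2, 1/2, 1/2, 0⟩, ⟨-1/2, 1/4, 0, 1/4⟩])))] {p : ℕ}, p.Prime → ¬ p ∣ 5 → ∀ j : ClassSet (Submodule.span ℤ (Set.range ![(⟨1, 0, 0, 0⟩ : ℍ[ℚ,-2,-5]), ⟨0, 1, 0, 0⟩, ⟨1/2, 1/2, 1/2, 0⟩, ⟨-1/2, 1/4, 0, 1/4⟩])), ∑ i, matrix (Submodule.span ℤ (Set.range ![(⟨1, 0, 0, 0⟩ : ℍ[ℚ,-2,-5]), ⟨0, 1, 0, 0⟩, ⟨1/2, 1/2,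 1/2, 0⟩, ⟨-1/2, 1/4, 0, 1/4⟩])) p i j = p + 1) ∧
    (∀ [Fintype (ClassSet (Submodule.span ℤ (Set.range ![(⟨1, 0, 0, 0⟩ : ℍ[ℚ,-2,-5]), ⟨0, 1, 0, 0⟩, ⟨1/2, 1/2, 1/2, 0⟩, ⟨-1/2, 1/4, 0, 1/4⟩])))] [DecidableEq (ClassSet (Submodule.span ℤ (Set.range ![(⟨1, 0, 0, 0⟩ : ℍ[ℚ,-2,-5]), ⟨0, 1, 0, 0⟩, ⟨1/2, 1/2, 1/2, 0⟩, ⟨-1/2, 1/4, 0, 1/4⟩])))], matrix (Submodule.span ℤ (Set.range ![(⟨1, 0, 0, 0⟩ : ℍ[ℚ,-2,-5]), ⟨0, 1, 0, 0⟩, ⟨1/2, 1/2, 1/2, 0⟩, ⟨-1/2, 1/4, 0, 1/4⟩])) 5 * matrix (Submodule.span ℤ (Set.range ![(⟨1, 0, 0, 0⟩ : ℍ[ℚ,-2,-5]), ⟨0, 1, 0, 0⟩, ⟨1/2, 1/2, 1/2, 0⟩, ⟨-1/2, 1/4, 0, 1/4⟩])) 5 = 1) ∧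
    (∀ [Fintype (ClassSet (Submodule.span ℤ (Set.range ![(⟨1, 0, 0, 0⟩ : ℍ[ℚ,-2,-5]), ⟨0, 1, 0, 0⟩, ⟨1/2, 1/2, 1/2, 0⟩, ⟨-1/2, 1/4, 0, 1/4⟩])))] {m n : ℕ}, Nat.Coprime m n → matrix (Submodule.span ℤ (Set.range ![(⟨1, 0, 0, 0⟩ : ℍ[ℚ,-2,-5]), ⟨0, 1, 0, 0⟩, ⟨1/2, 1/2, 1/2, 0⟩, ⟨-1/2, 1/4, 0, 1/4⟩])) (m * n) = matrix (Submodule.span ℤ (Set.range ![(⟨1, 0, 0, 0⟩ : ℍ[ℚ,-2,-5]), ⟨0, 1, 0, 0⟩, ⟨1/2, 1/2, 1/2, 0⟩, ⟨-1/2, 1/4, 0, 1/4⟩])) m * matrix (Submodule.span ℤ (Set.range ![(⟨1, 0, 0, 0⟩ : ℍ[ℚ,-2,-5]), ⟨0, 1, 0, 0⟩, ⟨1/2, 1/2, 1/2, 0⟩, ⟨-1/2, 1/4, 0, 1/4⟩])) n) ∧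
    (∀ {n : ℕ}, n ≠ 0 → ∀ i : ClassSet (Submodule.span ℤ (Set.range ![(⟨1, 0, 0, 0⟩ : ℍ[ℚ,-2,-5]), ⟨0, 1, 0, 0⟩, ⟨1/2, 1/2, 1/2, 0⟩, ⟨-1/2, 1/4, 0, 1/4⟩])), (2 * weight (Submodule.span ℤ (Set.range ![(⟨1, 0, 0, 0⟩ : ℍ[ℚ,-2,-5]), ⟨0, 1, 0, 0⟩, ⟨1/2, 1/2, 1/2, 0⟩, ⟨-1/2, 1/4, 0, 1/4⟩])) i : ℤ) * matrix (Submodule.span ℤ (Set.range ![(⟨1, 0, 0, 0⟩ : ℍ[ℚ,-2,-5]), ⟨0, 1, 0, 0⟩, ⟨1/2, 1/2, 1/2, 0⟩, ⟨-1/2, 1/4, 0, 1/4⟩])) n i i =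
      Nat.card {x : ℍ[ℚ,-2,-5] // x ∈ leftOrder i.rep ∧ reducedNorm ℚ ℍ[ℚ,-2,-5] x = n}) := by
  haveI := isQuaternionAlgebra
  let S : XiSetup 1 5 :=
    { D := ℍ[ℚ,-2,-5]
      isTotallyDefinite := isTotallyDefinite
      squarefree := Nat.prime_five.prime.squarefree
      ramifiedPlaces_eq := ramifiedPlaces_eq
      O := (Submodule.span ℤ (Set.range ![(⟨1, 0, 0, 0⟩ : ℍ[ℚ,-2,-5]), ⟨0, 1, 0, 0⟩, ⟨1/2, 1/2, 1/2, 0⟩, ⟨-1/2, 1/4, 0, 1/4⟩]))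
      isEichlerOrder := brandt_isEichlerOrder_one_lattice }
  refine ⟨fun {_} {p} hp hp5 j => ?_, fun {_} {_} => ?_, fun {_} {m} {n} hmn => ?_, fun {n} hn i => ?_⟩
  · exact S.sum_matrix_prime_eq hp (by rwa [one_mul]) j
  · exact S.matrix_mul_self_of_dvd Nat.prime_five (dvd_refl 5)
  · exact S.matrix_mul_of_coprime hmn
  · exact S.two_mul_weight_mul_matrix_diag hn i

/-- The Brandt matrices have non-negative entries (they count ideals). [folklore] -/
private theorem matrix_nonneg (n : ℕ) (i j : ClassSet (Submodule.span ℤ (Set.range ![(⟨1, 0, 0, 0⟩ : ℍ[ℚ,-2,-5]), ⟨0, 1, 0, 0⟩, ⟨1/2, 1/2, 1/2, 0⟩, ⟨-1/2, 1/4, 0, 1/4⟩]))) : 0 ≤ matrix (Submodule.span ℤ (Set.range ![(⟨1, 0, 0, 0⟩ : ℍ[ℚ,-2,-5]), ⟨0, 1, 0, 0⟩, ⟨1/2, 1/2, 1/2, 0⟩, ⟨-1/2, 1/4, 0, 1/4⟩])) n i j := by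
  rw [matrix, Matrix.of_apply]
  exact Int.natCast_nonneg _

/-- **`T(p)_ij = p + 1` for every prime `p ≠ 5`** (at `O₅`: the `p + 1` right ideals of reduced norm `p` of a maximal order at
a split prime, on the one-point class set). [cite: Voight2021, Exercise 11.14 (c) and Thm. 25.4.1 (D = 5)] [cite: Eichler1973, Ch. II §6 (16)] -/
theorem matrix_prime {p : ℕ} (hp : p.Prime) (hp5 : p ≠ 5) (i j : ClassSet (Submodule.span ℤ (Set.range ![(⟨1, 0, 0, 0⟩ : ℍ[ℚ,-2,-5]), ⟨0, 1, 0, 0⟩, ⟨1/2, 1/2, 1/2, 0⟩, ⟨-1/2, 1/4, 0, 1/4⟩]))) : matrix (Submodule.span ℤ (Set.range ![(⟨1, 0, 0, 0⟩ : ℍ[ℚ,-2,-5]), ⟨0, 1, 0, 0⟩, ⟨1/2, 1/2, 1/2, 0⟩, ⟨-1/2, 1/4, 0, 1/4⟩])) p i j = p + 1 := by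
  haveI := finite_classSet₅
  haveI := subsingleton_classSet
  letI := Fintype.ofFinite (ClassSet (Submodule.span ℤ (Set.range ![(⟨1, 0, 0, 0⟩ : ℍ[ℚ,-2,-5]), ⟨0, 1, 0, 0⟩, ⟨1/2, 1/2, 1/2, 0⟩, ⟨-1/2, 1/4, 0, 1/4⟩])))
  have h := setup_facts.1 hp (fun h5 => hp5 ((Nat.prime_dvd_prime_iff_eq hp Nat.prime_five).1 h5)) j
  rwa [Fintype.sum_subsingleton _ i] at h

/-- **`T(5)² = 1`** (the ramified prime: `T(5)` is an involutive permutation matrix). [cite: Eichler1973, Ch. II §6 Thm. 2 (20)] [cite: VignerasLNM800, Ch. III §5 exercice 5.8 (b)] -/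
theorem matrix_five_mul_self [Fintype (ClassSet (Submodule.span ℤ (Set.range ![(⟨1, 0, 0, 0⟩ : ℍ[ℚ,-2,-5]), ⟨0, 1, 0, 0⟩, ⟨1/2, 1/2, 1/2, 0⟩, ⟨-1/2, 1/4, 0, 1/4⟩])))] [DecidableEq (ClassSet (Submodule.span ℤ (Set.range ![(⟨1, 0, 0, 0⟩ : ℍ[ℚ,-2,-5]), ⟨0, 1, 0, 0⟩, ⟨1/2, 1/2, 1/2, 0⟩, ⟨-1/2, 1/4, 0, 1/4⟩])))] : matrix (Submodule.span ℤ (Set.range ![(⟨1, 0, 0, 0⟩ : ℍ[ℚ,-2,-5]), ⟨0, 1, 0, 0⟩, ⟨1/2, 1/2, 1/2, 0⟩, ⟨-1/2, 1/4, 0, 1/4⟩])) 5 * matrix (Submodule.span ℤ (Set.range ![(⟨1, 0, 0, 0⟩ : ℍ[ℚ,-2,-5]), ⟨0, 1, 0, 0⟩, ⟨1/2, 1/2, 1/2, 0⟩, ⟨-1/2, 1/4, 0, 1/4⟩])) 5 = 1 :=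
  setup_facts.2.1

/-- `T(1)_ij = 1`. [cite: Voight2021, 41.1.1] -/
theorem matrix_one' (i j : ClassSet (Submodule.span ℤ (Set.range ![(⟨1, 0, 0, 0⟩ : ℍ[ℚ,-2,-5]), ⟨0, 1, 0, 0⟩, ⟨1/2, 1/2, 1/2, 0⟩, ⟨-1/2, 1/4, 0, 1/4⟩]))) : matrix (Submodule.span ℤ (Set.range ![(⟨1, 0, 0, 0⟩ : ℍ[ℚ,-2,-5]), ⟨0, 1, 0, 0⟩, ⟨1/2, 1/2, 1/2, 0⟩, ⟨-1/2, 1/4, 0, 1/4⟩])) 1 i j = 1 := by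
  classical
  haveI := subsingleton_classSet
  rw [matrix_one, Subsingleton.elim i j, Matrix.one_apply_eq]

/-- `T(mn) = T(m) T(n)` for coprime `m, n` (at `O₅`). [cite: VignerasLNM800, Ch. III §5 exercice 5.8 (c)] -/
theorem matrix_mul_of_coprime' [Fintype (ClassSet (Submodule.span ℤ (Set.range ![(⟨1, 0, 0, 0⟩ : ℍ[ℚ,-2,-5]), ⟨0, 1, 0, 0⟩, ⟨1/2, 1/2, 1/2, 0⟩, ⟨-1/2, 1/4, 0, 1/4⟩])))] {m n : ℕ} (hmn : Nat.Coprime m n) :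
    matrix (Submodule.span ℤ (Set.range ![(⟨1, 0, 0, 0⟩ : ℍ[ℚ,-2,-5]), ⟨0, 1, 0, 0⟩, ⟨1/2, 1/2, 1/2, 0⟩, ⟨-1/2, 1/4, 0, 1/4⟩])) (m * n) = matrix (Submodule.span ℤ (Set.range ![(⟨1, 0, 0, 0⟩ : ℍ[ℚ,-2,-5]), ⟨0, 1, 0, 0⟩, ⟨1/2, 1/2, 1/2, 0⟩, ⟨-1/2, 1/4, 0, 1/4⟩])) m * matrix (Submodule.span ℤ (Set.range ![(⟨1, 0, 0, 0⟩ : ℍ[ℚ,-2,-5]), ⟨0, 1, 0, 0⟩, ⟨1/2, 1/2, 1/2, 0⟩, ⟨-1/2, 1/4, 0, 1/4⟩])) n :=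
  setup_facts.2.2.1 hmn

/-- Products of `1 × 1` matrices, entrywise. [folklore] -/
private theorem mul_apply₅ [Fintype (ClassSet (Submodule.span ℤ (Set.range ![(⟨1, 0, 0, 0⟩ : ℍ[ℚ,-2,-5]), ⟨0, 1, 0, 0⟩, ⟨1/2, 1/2, 1/2, 0⟩, ⟨-1/2, 1/4, 0, 1/4⟩])))] (A C : Matrix (ClassSet (Submodule.span ℤ (Set.range ![(⟨1, 0, 0, 0⟩ : ℍ[ℚ,-2,-5]), ⟨0, 1, 0, 0⟩, ⟨1/2, 1/2, 1/2, 0⟩, ⟨-1/2, 1/4, 0, 1/4⟩]))) (ClassSet (Submodule.span ℤ (Set.range ![(⟨1, 0, 0, 0⟩ : ℍ[ℚ,-2,-5]), ⟨0, 1, 0, 0⟩, ⟨1/2, 1/2, 1/2, 0⟩, ⟨-1/2, 1/4, 0, 1/4⟩]))) ℤ) (i j : ClassSet (Submodule.span ℤ (Set.range ![(⟨1, 0, 0, 0⟩ : ℍ[ℚ,-2,-5]), ⟨0, 1, 0, 0⟩, ⟨1/2, 1/2, 1/2, 0⟩, ⟨-1/2, 1/4, 0, 1/4⟩]))) :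
    (A * C) i j = A i j * C i j := by
  haveI := subsingleton_classSet
  rw [Matrix.mul_apply, Fintype.sum_subsingleton _ i, Subsingleton.elim j i]

/-- `T(mn)_ij = T(m)_ij T(n)_ij` for coprime `m, n` (one class). [cite: VignerasLNM800, Ch. III §5 exercice 5.8 (c)] -/
theorem matrix_apply_mul_of_coprime {m n : ℕ} (hmn : Nat.Coprime m n) (i j : ClassSet (Submodule.span ℤ (Set.range ![(⟨1, 0, 0, 0⟩ : ℍ[ℚ,-2,-5]), ⟨0, 1, 0, 0⟩, ⟨1/2, 1/2, 1/2, 0⟩, ⟨-1/2, 1/4, 0, 1/4⟩]))) :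
    matrix (Submodule.span ℤ (Set.range ![(⟨1, 0, 0, 0⟩ : ℍ[ℚ,-2,-5]), ⟨0, 1, 0, 0⟩, ⟨1/2, 1/2, 1/2, 0⟩, ⟨-1/2, 1/4, 0, 1/4⟩])) (m * n) i j = matrix (Submodule.span ℤ (Set.range ![(⟨1, 0, 0, 0⟩ : ℍ[ℚ,-2,-5]), ⟨0, 1, 0, 0⟩, ⟨1/2, 1/2, 1/2, 0⟩, ⟨-1/2, 1/4, 0, 1/4⟩])) m i j * matrix (Submodule.span ℤ (Set.range ![(⟨1, 0, 0, 0⟩ : ℍ[ℚ,-2,-5]), ⟨0, 1, 0, 0⟩, ⟨1/2, 1/2, 1/2, 0⟩, ⟨-1/2, 1/4, 0, 1/4⟩])) n i j := by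
  haveI := finite_classSet₅
  letI := Fintype.ofFinite (ClassSet (Submodule.span ℤ (Set.range ![(⟨1, 0, 0, 0⟩ : ℍ[ℚ,-2,-5]), ⟨0, 1, 0, 0⟩, ⟨1/2, 1/2, 1/2, 0⟩, ⟨-1/2, 1/4, 0, 1/4⟩])))
  rw [matrix_mul_of_coprime' hmn, mul_apply₅]

/-- **`#{x ∈ O₅ : nrd x = n} = 6 · T(n)_ii`** (`2w = #O₅^× = 6`; the numerators are class functions). [cite: Voight2021, Lemma 41.2.7 and Thm. 11.5.14] -/
theorem natCard_reducedNorm_eq_six_mul_matrix {n : ℕ} (hn : n ≠ 0) (i : ClassSet (Submodule.span ℤ (Set.range ![(⟨1, 0, 0, 0⟩ : ℍ[ℚ,-2,-5]), ⟨0, 1, 0, 0⟩, ⟨1/2, 1/2, 1/2, 0⟩, ⟨-1/2, 1/4, 0, 1/4⟩]))) :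
    (Nat.card {x : ℍ[ℚ,-2,-5] // x ∈ (Submodule.span ℤ (Set.range ![(⟨1, 0, 0, 0⟩ : ℍ[ℚ,-2,-5]), ⟨0, 1, 0, 0⟩, ⟨1/2, 1/2, 1/2, 0⟩, ⟨-1/2, 1/4, 0, 1/4⟩])) ∧ reducedNorm ℚ ℍ[ℚ,-2,-5] x = n} : ℤ) = 6 * matrix (Submodule.span ℤ (Set.range ![(⟨1, 0, 0, 0⟩ : ℍ[ℚ,-2,-5]), ⟨0, 1, 0, 0⟩, ⟨1/2, 1/2, 1/2, 0⟩, ⟨-1/2, 1/4, 0, 1/4⟩])) n i i := by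
  have h := setup_facts.2.2.2 hn i
  rw [weight_eq_three, card_normSet_rep] at h
  push_cast at h
  linarith

/-- **`T(5ᵃ)_ij = 1` for every `a`** (`6·T(5ᵃ)_ii = #{x ∈ O₅ : nrd x = 5ᵃ} = 6`: the elements of norm `5ᵃ` are the `6` units
times `jᵃ` — the unique two-sided ideal `𝔓ᵃ` above the ramified prime). [cite: Eichler1973, Ch. II §6 Thm. 2 (20)] [cite: Voight2021, Exercise 17.10] -/
theorem matrix_five_pow (a : ℕ) (i j : ClassSet (Submodule.span ℤ (Set.range ![(⟨1, 0, 0, 0⟩ : ℍ[ℚ,-2,-5]), ⟨0, 1, 0, 0⟩, ⟨1/2, 1/2, 1/2, 0⟩, ⟨-1/2, 1/4, 0, 1/4⟩]))) : matrix (Submodule.span ℤ (Set.range ![(⟨1, 0, 0, 0⟩ : ℍ[ℚ,-2,-5]), ⟨0, 1, 0, 0⟩, ⟨1/2, 1/2, 1/2, 0⟩, ⟨-1/2, 1/4, 0, 1/4⟩])) (5 ^ a) i j = 1 := by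
  haveI := finite_classSet₅
  haveI := subsingleton_classSet
  rw [Subsingleton.elim i j]
  have h := natCard_reducedNorm_eq_six_mul_matrix (pow_ne_zero a (by norm_num : (5 : ℕ) ≠ 0)) j
  rw [natCard_reducedNorm_five_pow a] at h
  push_cast at h
  linarith

/-- **`T(5)_ij = 1`** (the ramified prime). [cite: Eichler1973, Ch. II §6 Thm. 2 (20)] [cite: VignerasLNM800, Ch. III §5 exercice 5.8 (b)] -/
theorem matrix_five (i j : ClassSet (Submodule.span ℤ (Set.range ![(⟨1, 0, 0, 0⟩ : ℍ[ℚ,-2,-5]), ⟨0, 1, 0, 0⟩, ⟨1/2, 1/2, 1/2, 0⟩, ⟨-1/2, 1/4, 0, 1/4⟩]))) : matrix (Submodule.span ℤ (Set.range ![(⟨1, 0, 0, 0⟩ : ℍ[ℚ,-2,-5]), ⟨0, 1, 0, 0⟩, ⟨1/2, 1/2, 1/2, 0⟩, ⟨-1/2, 1/4, 0, 1/4⟩])) 5 i j = 1 := by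
  have h := matrix_five_pow 1 i j
  rwa [pow_one] at h

/-- **`#{x ∈ O₅ : nrd x = p} = 6(p + 1)` for every prime `p ≠ 5`.** [cite: Voight2021, Exercise 11.14 (c)–(d) (the analogous count for the Hurwitz order) and Exercise 17.10] [cite: Eichler1973, Ch. II §6 Thm. 2 Cor. 1] -/
theorem natCard_reducedNorm_prime {p : ℕ} (hp : p.Prime) (hp5 : p ≠ 5) :
    Nat.card {x : ℍ[ℚ,-2,-5] // x ∈ (Submodule.span ℤ (Set.range ![(⟨1, 0, 0, 0⟩ : ℍ[ℚ,-2,-5]), ⟨0, 1, 0, 0⟩, ⟨1/2, 1/2, 1/2, 0⟩, ⟨-1/2, 1/4, 0, 1/4⟩])) ∧ reducedNorm ℚ ℍ[ℚ,-2,-5] x = p} = 6 * (p + 1) := by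
  haveI := finite_classSet₅
  have c₀ : ClassSet (Submodule.span ℤ (Set.range ![(⟨1, 0, 0, 0⟩ : ℍ[ℚ,-2,-5]), ⟨0, 1, 0, 0⟩, ⟨1/2, 1/2, 1/2, 0⟩, ⟨-1/2, 1/4, 0, 1/4⟩])) := Quotient.mk (rightClassSetoid (Submodule.span ℤ (Set.range ![(⟨1, 0, 0, 0⟩ : ℍ[ℚ,-2,-5]), ⟨0, 1, 0, 0⟩, ⟨1/2, 1/2, 1/2, 0⟩, ⟨-1/2, 1/4, 0, 1/4⟩]))) ⟨(Submodule.span ℤ (Set.range ![(⟨1, 0, 0, 0⟩ : ℍ[ℚ,-2,-5]), ⟨0, 1, 0, 0⟩, ⟨1/2, 1/2, 1/2, 0⟩, ⟨-1/2, 1/4, 0, 1/4⟩])), lattice_mem_rightIdeals⟩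
  have h := natCard_reducedNorm_eq_six_mul_matrix hp.ne_zero c₀
  rw [matrix_prime hp hp5] at h
  exact_mod_cast h

/-- The count in the coordinates of `O₅`, for a natural number `n`. [cite: Voight2021, Exercise 17.10 (b)] -/
theorem natCard_form_eq_natCard_reducedNorm (n : ℕ) :
    Nat.card {v : ℤ × ℤ × ℤ × ℤ //
        v.1 ^ 2 + 2 * v.2.1 ^ 2 + 2 * v.2.2.1 ^ 2 + v.2.2.2 ^ 2 + v.1 * v.2.2.1 - v.1 * v.2.2.2 +
          2 * v.2.1 * v.2.2.1 + v.2.1 * v.2.2.2 = n} =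
      Nat.card {x : ℍ[ℚ,-2,-5] // x ∈ (Submodule.span ℤ (Set.range ![(⟨1, 0, 0, 0⟩ : ℍ[ℚ,-2,-5]), ⟨0, 1, 0, 0⟩, ⟨1/2, 1/2, 1/2, 0⟩, ⟨-1/2, 1/4, 0, 1/4⟩])) ∧ reducedNorm ℚ ℍ[ℚ,-2,-5] x = n} := by
  rw [← natCard_reducedNorm_eq_natCard_form (n : ℤ)]
  exact Nat.card_congr (Equiv.subtypeEquivRight fun x => by rw [Int.cast_natCast])

/-- **EICHLER'S ROW SUM AT PRIMES: the number of `(a, b, c, d) ∈ ℤ⁴` with `a² + 2b² + 2c² + d² + ac − ad + 2bc + bd = p` is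
`6(p + 1)` for every prime `p ≠ 5`** (by `# Cls O₅ = 1` and Eichler's `p + 1` ideals of norm `p`). [cite: Eichler1973, Ch. II §6 Thm. 2 Cor. 1] [cite: Voight2021, Exercise 17.10 (b) and Exercise 11.14 (c)] -/
theorem natCard_form_prime {p : ℕ} (hp : p.Prime) (hp5 : p ≠ 5) :
    Nat.card {v : ℤ × ℤ × ℤ × ℤ //
        v.1 ^ 2 + 2 * v.2.1 ^ 2 + 2 * v.2.2.1 ^ 2 + v.2.2.2 ^ 2 + v.1 * v.2.2.1 - v.1 * v.2.2.2 +
          2 * v.2.1 * v.2.2.1 + v.2.1 * v.2.2.2 = p} = 6 * (p + 1) := by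
  rw [natCard_form_eq_natCard_reducedNorm, natCard_reducedNorm_prime hp hp5]

/-- `σ(p) = p + 1`. [folklore] -/
private theorem sigma_one_prime {p : ℕ} (hp : p.Prime) : ArithmeticFunction.sigma 1 p = p + 1 := by
  have h := ArithmeticFunction.sigma_one_apply_prime_pow hp (i := 1)
  rw [pow_one] at h
  rw [h, Finset.sum_range_succ, Finset.sum_range_succ, Finset.sum_range_zero, pow_zero, pow_one, zero_add, add_comm]

/-- **`T(n)_ij = σ(n)` for squarefree `n` prime to `5`** (multiplicativity over the primes `p ∣ n`, `T(p) = p + 1 = σ(p)`).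
[cite: Eichler1973, Ch. II §6 (16), Thm. 2 (18) and Cor. 1] [cite: VignerasLNM800, Ch. III §5 exercice 5.8 (c)] -/
theorem matrix_apply_of_squarefree {n : ℕ} (hn : Squarefree n) (h5 : ¬ 5 ∣ n) (i j : ClassSet (Submodule.span ℤ (Set.range ![(⟨1, 0, 0, 0⟩ : ℍ[ℚ,-2,-5]), ⟨0, 1, 0, 0⟩, ⟨1/2, 1/2, 1/2, 0⟩, ⟨-1/2, 1/4, 0, 1/4⟩]))) :
    matrix (Submodule.span ℤ (Set.range ![(⟨1, 0, 0, 0⟩ : ℍ[ℚ,-2,-5]), ⟨0, 1, 0, 0⟩, ⟨1/2, 1/2, 1/2, 0⟩, ⟨-1/2, 1/4, 0, 1/4⟩])) n i j = ArithmeticFunction.sigma 1 n := by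
  induction n using Nat.recOnPrimeCoprime generalizing i j with
  | zero => exact absurd hn not_squarefree_zero
  | prime_pow p a hp =>
    rcases Nat.eq_zero_or_pos a with rfl | ha
    · rw [pow_zero, matrix_one', ArithmeticFunction.sigma_one_apply, Nat.divisors_one, sum_singleton, Nat.cast_one]
    · have ha1 : a = 1 := ((Nat.squarefree_pow_iff hp.ne_one ha.ne').1 hn).2
      subst ha1
      rw [pow_one] at h5 ⊢
      have hp5 : p ≠ 5 := fun h => h5 (h ▸ dvd_refl p)
      rw [matrix_prime hp hp5, sigma_one_prime hp, Nat.cast_add, Nat.cast_one]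
  | coprime a b ha hb hab iha ihb =>
    rw [matrix_apply_mul_of_coprime hab, iha (Squarefree.of_mul_left hn) (fun h => h5 (dvd_mul_of_dvd_left h b)),
      ihb (Squarefree.of_mul_right hn) (fun h => h5 (dvd_mul_of_dvd_right h a)),
      ArithmeticFunction.isMultiplicative_sigma.map_mul_of_coprime hab, Nat.cast_mul]

/-- **`T(5ᵃm)_ij = T(m)_ij` for `m` prime to `5`** (`T(5ᵃ) = 1`). [cite: Eichler1973, Ch. II §6 Thm. 2 (18), (20)] -/
theorem matrix_apply_five_pow_mul (a : ℕ) {m : ℕ} (h5 : ¬ 5 ∣ m) (i j : ClassSet (Submodule.span ℤ (Set.range ![(⟨1, 0, 0, 0⟩ : ℍ[ℚ,-2,-5]), ⟨0, 1, 0, 0⟩, ⟨1/2, 1/2, 1/2, 0⟩, ⟨-1/2, 1/4, 0, 1/4⟩]))) :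
    matrix (Submodule.span ℤ (Set.range ![(⟨1, 0, 0, 0⟩ : ℍ[ℚ,-2,-5]), ⟨0, 1, 0, 0⟩, ⟨1/2, 1/2, 1/2, 0⟩, ⟨-1/2, 1/4, 0, 1/4⟩])) (5 ^ a * m) i j = matrix (Submodule.span ℤ (Set.range ![(⟨1, 0, 0, 0⟩ : ℍ[ℚ,-2,-5]), ⟨0, 1, 0, 0⟩, ⟨1/2, 1/2, 1/2, 0⟩, ⟨-1/2, 1/4, 0, 1/4⟩])) m i j := by
  rw [matrix_apply_mul_of_coprime (Nat.Coprime.pow_left a ((Nat.Prime.coprime_iff_not_dvd Nat.prime_five).2 h5)),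
    matrix_five_pow, one_mul]

/-- **`T(5ᵃm)_ij = σ(m)` for squarefree `m` prime to `5`.** [cite: Eichler1973, Ch. II §6 Thm. 2 (18), (20) and Cor. 1] -/
theorem matrix_apply_five_pow_mul_of_squarefree (a : ℕ) {m : ℕ} (hm : Squarefree m) (h5 : ¬ 5 ∣ m) (i j : ClassSet (Submodule.span ℤ (Set.range ![(⟨1, 0, 0, 0⟩ : ℍ[ℚ,-2,-5]), ⟨0, 1, 0, 0⟩, ⟨1/2, 1/2, 1/2, 0⟩, ⟨-1/2, 1/4, 0, 1/4⟩]))) :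
    matrix (Submodule.span ℤ (Set.range ![(⟨1, 0, 0, 0⟩ : ℍ[ℚ,-2,-5]), ⟨0, 1, 0, 0⟩, ⟨1/2, 1/2, 1/2, 0⟩, ⟨-1/2, 1/4, 0, 1/4⟩])) (5 ^ a * m) i j = ArithmeticFunction.sigma 1 m := by
  rw [matrix_apply_five_pow_mul a h5, matrix_apply_of_squarefree hm h5]

/-- **EICHLER'S ROW SUM FOR SQUAREFREE `n` PRIME TO `5`: `r₅(n) = #{a² + 2b² + 2c² + d² + ac − ad + 2bc + bd = n} = 6σ(n)`.**
[cite: Eichler1973, Ch. II §6 Thm. 2 Cor. 1] [cite: Voight2021, Exercise 17.10 (b)] -/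
theorem natCard_form_of_squarefree {n : ℕ} (hn : Squarefree n) (h5 : ¬ 5 ∣ n) :
    Nat.card {v : ℤ × ℤ × ℤ × ℤ //
        v.1 ^ 2 + 2 * v.2.1 ^ 2 + 2 * v.2.2.1 ^ 2 + v.2.2.2 ^ 2 + v.1 * v.2.2.1 - v.1 * v.2.2.2 +
          2 * v.2.1 * v.2.2.1 + v.2.1 * v.2.2.2 = n} =
      6 * ArithmeticFunction.sigma 1 n := by
  haveI := finite_classSet₅
  have c₀ : ClassSet (Submodule.span ℤ (Set.range ![(⟨1, 0, 0, 0⟩ : ℍ[ℚ,-2,-5]), ⟨0, 1, 0, 0⟩, ⟨1/2, 1/2, 1/2, 0⟩, ⟨-1/2, 1/4, 0, 1/4⟩])) := Quotient.mk (rightClassSetoid (Submodule.span ℤ (Set.range ![(⟨1, 0, 0, 0⟩ : ℍ[ℚ,-2,-5]), ⟨0, 1, 0, 0⟩, ⟨1/2, 1/2, 1/2, 0⟩, ⟨-1/2, 1/4, 0, 1/4⟩]))) ⟨(Submodule.span ℤ (Set.range ![(⟨1, 0, 0, 0⟩ : ℍ[ℚ,-2,-5]), ⟨0, 1, 0, 0⟩,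 ⟨1/2, 1/2, 1/2, 0⟩, ⟨-1/2, 1/4, 0, 1/4⟩])), lattice_mem_rightIdeals⟩
  have h := natCard_reducedNorm_eq_six_mul_matrix hn.ne_zero c₀
  rw [matrix_apply_of_squarefree hn h5, ← natCard_form_eq_natCard_reducedNorm] at h
  exact_mod_cast h

/-- **`r₅(5ᵃm) = 6σ(m)` for squarefree `m` prime to `5`** (`= 6·Σ_{d ∣ 5ᵃm, 5 ∤ d} d`). [cite: Eichler1973, Ch. II §6 Thm. 2 (20) and Cor. 1] [cite: Voight2021, Exercise 17.10 (b)] -/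
theorem natCard_form_five_pow_mul_of_squarefree (a : ℕ) {m : ℕ} (hm : Squarefree m) (h5 : ¬ 5 ∣ m) :
    Nat.card {v : ℤ × ℤ × ℤ × ℤ //
        v.1 ^ 2 + 2 * v.2.1 ^ 2 + 2 * v.2.2.1 ^ 2 + v.2.2.2 ^ 2 + v.1 * v.2.2.1 - v.1 * v.2.2.2 +
          2 * v.2.1 * v.2.2.1 + v.2.1 * v.2.2.2 = (5 ^ a * m : ℕ)} =
      6 * ArithmeticFunction.sigma 1 m := by
  haveI := finite_classSet₅
  have c₀ : ClassSet (Submodule.span ℤ (Set.range ![(⟨1, 0, 0, 0⟩ : ℍ[ℚ,-2,-5]), ⟨0, 1, 0, 0⟩, ⟨1/2, 1/2, 1/2, 0⟩, ⟨-1/2, 1/4, 0, 1/4⟩])) := Quotient.mk (rightClassSetoid (Submodule.span ℤ (Set.range ![(⟨1, 0, 0, 0⟩ : ℍ[ℚ,-2,-5]), ⟨0, 1, 0, 0⟩, ⟨1/2, 1/2, 1/2, 0⟩, ⟨-1/2, 1/4, 0, 1/4⟩]))) ⟨(Submodule.span ℤ (Set.range ![(⟨1, 0, 0, 0⟩ :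 ℍ[ℚ,-2,-5]), ⟨0, 1, 0, 0⟩, ⟨1/2, 1/2, 1/2, 0⟩, ⟨-1/2, 1/4, 0, 1/4⟩])), lattice_mem_rightIdeals⟩
  have h := natCard_reducedNorm_eq_six_mul_matrix (mul_ne_zero (pow_ne_zero a (by norm_num : (5 : ℕ) ≠ 0)) hm.ne_zero) c₀
  rw [matrix_apply_five_pow_mul_of_squarefree a hm h5, ← natCard_form_eq_natCard_reducedNorm] at h
  exact_mod_cast h

/-- **`#{x ∈ O₅ : nrd x = 5ᵃm} = 6σ(m)` for squarefree `m` prime to `5`.** [cite: Eichler1973, Ch. II §6 Thm. 2 (20) and Cor. 1] -/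
theorem natCard_reducedNorm_five_pow_mul_of_squarefree (a : ℕ) {m : ℕ} (hm : Squarefree m) (h5 : ¬ 5 ∣ m) :
    Nat.card {x : ℍ[ℚ,-2,-5] // x ∈ (Submodule.span ℤ (Set.range ![(⟨1, 0, 0, 0⟩ : ℍ[ℚ,-2,-5]), ⟨0, 1, 0, 0⟩, ⟨1/2, 1/2, 1/2, 0⟩, ⟨-1/2, 1/4, 0, 1/4⟩])) ∧ reducedNorm ℚ ℍ[ℚ,-2,-5] x = (5 ^ a * m : ℕ)} = 6 * ArithmeticFunction.sigma 1 m := by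
  rw [← natCard_form_eq_natCard_reducedNorm, natCard_form_five_pow_mul_of_squarefree a hm h5]

end AtO

/-! ## §1' The first non-squarefree arguments: `T(4) = 7`, `T(8) = 15`, `T(9) = 13`, `T(16) = 31`, Eichler's recursion at `2, 3` -/

section Hecke

/-- **`r₅(9) = 78 = 6σ(9)`** (certified enumeration over the box `|a| ≤ 7`, `|b| ≤ 5`, `|c| ≤ 3`, `|d| ≤ 4`).
[cite: Eichler1973, Ch. II §6 Thm. 2 (19) and Cor. 1] -/
theorem natCard_form_nine :
    Nat.card {v : ℤ × ℤ × ℤ × ℤ //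
        v.1 ^ 2 + 2 * v.2.1 ^ 2 + 2 * v.2.2.1 ^ 2 + v.2.2.2 ^ 2 + v.1 * v.2.2.1 - v.1 * v.2.2.2 +
          2 * v.2.1 * v.2.2.1 + v.2.1 * v.2.2.2 = 9} = 78 := by
  rw [natCard_form_eq_card_filter_box 9 7 5 3 4 (by norm_num) (by norm_num) (by norm_num) (by norm_num) (by norm_num) (by norm_num)
    (by norm_num) (by norm_num)]
  decide +kernel

/-- **`r₅(16) = 186 = 6σ(16)`** (certified enumeration over the box `|a| ≤ 9`, `|b| ≤ 6`, `|c| ≤ 4`, `|d| ≤ 5`).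
[cite: Eichler1973, Ch. II §6 Thm. 2 (19) and Cor. 1] -/
theorem natCard_form_sixteen :
    Nat.card {v : ℤ × ℤ × ℤ × ℤ //
        v.1 ^ 2 + 2 * v.2.1 ^ 2 + 2 * v.2.2.1 ^ 2 + v.2.2.2 ^ 2 + v.1 * v.2.2.1 - v.1 * v.2.2.2 +
          2 * v.2.1 * v.2.2.1 + v.2.1 * v.2.2.2 = 16} = 186 := by
  rw [natCard_form_eq_card_filter_box 16 9 6 4 5 (by norm_num) (by norm_num) (by norm_num) (by norm_num) (by norm_num) (by norm_num)
    (by norm_num) (by norm_num)]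
  decide +kernel

/-- `T(n)_ij` from `r₅(n) = 6·T(n)_ii` on the one-point class set. [cite: Eichler1973, Ch. II §6 Thm. 2 Cor. 1] -/
private theorem matrix_apply_of_natCard_form {n : ℕ} (hn : n ≠ 0) {s : ℕ}
    (hs : Nat.card {v : ℤ × ℤ × ℤ × ℤ //
        v.1 ^ 2 + 2 * v.2.1 ^ 2 + 2 * v.2.2.1 ^ 2 + v.2.2.2 ^ 2 + v.1 * v.2.2.1 - v.1 * v.2.2.2 +
          2 * v.2.1 * v.2.2.1 + v.2.1 * v.2.2.2 = n} = s)
    (i j : ClassSet (Submodule.span ℤ (Set.range ![(⟨1, 0, 0, 0⟩ : ℍ[ℚ,-2,-5]), ⟨0, 1, 0, 0⟩, ⟨1/2, 1/2, 1/2, 0⟩, ⟨-1/2, 1/4, 0, 1/4⟩]))) : 6 * matrix (Submodule.span ℤ (Set.range ![(⟨1, 0, 0, 0⟩ : ℍ[ℚ,-2,-5]), ⟨0, 1, 0, 0⟩, ⟨1/2, 1/2, 1/2, 0⟩, ⟨-1/2, 1/4, 0, 1/4⟩])) n i j = s := by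
  haveI := subsingleton_classSet
  rw [Subsingleton.elim j i]
  have h := natCard_reducedNorm_eq_six_mul_matrix hn i
  rw [← natCard_form_eq_natCard_reducedNorm, hs] at h
  exact_mod_cast h.symm

/-- `T(2)_ij = 3`. [cite: Eichler1973, Ch. II §6 (16)] -/
theorem matrix_two (i j : ClassSet (Submodule.span ℤ (Set.range ![(⟨1, 0, 0, 0⟩ : ℍ[ℚ,-2,-5]), ⟨0, 1, 0, 0⟩, ⟨1/2, 1/2, 1/2, 0⟩, ⟨-1/2, 1/4, 0, 1/4⟩]))) : matrix (Submodule.span ℤ (Set.range ![(⟨1, 0, 0, 0⟩ : ℍ[ℚ,-2,-5]), ⟨0, 1, 0, 0⟩, ⟨1/2, 1/2, 1/2, 0⟩, ⟨-1/2, 1/4, 0, 1/4⟩])) 2 i j = 3 := by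
  rw [matrix_prime Nat.prime_two (by norm_num) i j]
  norm_num

/-- `T(3)_ij = 4`. [cite: Eichler1973, Ch. II §6 (16)] -/
theorem matrix_three (i j : ClassSet (Submodule.span ℤ (Set.range ![(⟨1, 0, 0, 0⟩ : ℍ[ℚ,-2,-5]), ⟨0, 1, 0, 0⟩, ⟨1/2, 1/2, 1/2, 0⟩, ⟨-1/2, 1/4, 0, 1/4⟩]))) : matrix (Submodule.span ℤ (Set.range ![(⟨1, 0, 0, 0⟩ : ℍ[ℚ,-2,-5]), ⟨0, 1, 0, 0⟩, ⟨1/2, 1/2, 1/2, 0⟩, ⟨-1/2, 1/4, 0, 1/4⟩])) 3 i j = 4 := by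
  rw [matrix_prime Nat.prime_three (by norm_num) i j]
  norm_num

/-- **`T(4)_ij = 7`** (`6·T(4) = r₅(4) = 42`). [cite: Eichler1973, Ch. II §6 Thm. 2 (19) and Cor. 1] -/
theorem matrix_four (i j : ClassSet (Submodule.span ℤ (Set.range ![(⟨1, 0, 0, 0⟩ : ℍ[ℚ,-2,-5]), ⟨0, 1, 0, 0⟩, ⟨1/2, 1/2, 1/2, 0⟩, ⟨-1/2, 1/4, 0, 1/4⟩]))) : matrix (Submodule.span ℤ (Set.range ![(⟨1, 0, 0, 0⟩ : ℍ[ℚ,-2,-5]), ⟨0, 1, 0, 0⟩, ⟨1/2, 1/2, 1/2, 0⟩, ⟨-1/2, 1/4, 0, 1/4⟩])) 4 i j = 7 := by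
  have h := matrix_apply_of_natCard_form (n := 4) (s := 42) (by norm_num) (by exact_mod_cast natCard_form_four) i j
  omega

/-- **`T(8)_ij = 15`** (`6·T(8) = r₅(8) = 90`). [cite: Eichler1973, Ch. II §6 Thm. 2 (19) and Cor. 1] -/
theorem matrix_eight (i j : ClassSet (Submodule.span ℤ (Set.range ![(⟨1, 0, 0, 0⟩ : ℍ[ℚ,-2,-5]), ⟨0, 1, 0, 0⟩, ⟨1/2, 1/2, 1/2, 0⟩, ⟨-1/2, 1/4, 0, 1/4⟩]))) : matrix (Submodule.span ℤ (Set.range ![(⟨1, 0, 0, 0⟩ : ℍ[ℚ,-2,-5]), ⟨0, 1, 0, 0⟩, ⟨1/2, 1/2, 1/2, 0⟩, ⟨-1/2, 1/4, 0, 1/4⟩])) 8 i j = 15 := by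
  have h := matrix_apply_of_natCard_form (n := 8) (s := 90) (by norm_num) (by exact_mod_cast natCard_form_eight) i j
  omega

/-- **`T(9)_ij = 13`** (`6·T(9) = r₅(9) = 78`). [cite: Eichler1973, Ch. II §6 Thm. 2 (19) and Cor. 1] -/
theorem matrix_nine (i j : ClassSet (Submodule.span ℤ (Set.range ![(⟨1, 0, 0, 0⟩ : ℍ[ℚ,-2,-5]), ⟨0, 1, 0, 0⟩, ⟨1/2, 1/2, 1/2, 0⟩, ⟨-1/2, 1/4, 0, 1/4⟩]))) : matrix (Submodule.span ℤ (Set.range ![(⟨1, 0, 0, 0⟩ : ℍ[ℚ,-2,-5]), ⟨0, 1, 0, 0⟩, ⟨1/2, 1/2, 1/2, 0⟩, ⟨-1/2, 1/4, 0, 1/4⟩])) 9 i j = 13 := by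
  have h := matrix_apply_of_natCard_form (n := 9) (s := 78) (by norm_num) (by exact_mod_cast natCard_form_nine) i j
  omega

/-- **`T(16)_ij = 31`** (`6·T(16) = r₅(16) = 186`). [cite: Eichler1973, Ch. II §6 Thm. 2 (19) and Cor. 1] -/
theorem matrix_sixteen (i j : ClassSet (Submodule.span ℤ (Set.range ![(⟨1, 0, 0, 0⟩ : ℍ[ℚ,-2,-5]), ⟨0, 1, 0, 0⟩, ⟨1/2, 1/2, 1/2, 0⟩, ⟨-1/2, 1/4, 0, 1/4⟩]))) : matrix (Submodule.span ℤ (Set.range ![(⟨1, 0, 0, 0⟩ : ℍ[ℚ,-2,-5]), ⟨0, 1, 0, 0⟩, ⟨1/2, 1/2, 1/2, 0⟩, ⟨-1/2, 1/4, 0, 1/4⟩])) 16 i j = 31 := by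
  have h := matrix_apply_of_natCard_form (n := 16) (s := 186) (by norm_num) (by exact_mod_cast natCard_form_sixteen) i j
  omega

/-- **EICHLER'S RECURSION (19) AT `p = 2`, `μ = ν = 1`, FOR `O₅`: `B(2)B(2) = B(4) + 2·B(1)`** (`3·3 = 7 + 2`).
[cite: Eichler1973, Ch. II §6 Thm. 2 (19)] -/
theorem matrix_two_mul_matrix_two [Fintype (ClassSet (Submodule.span ℤ (Set.range ![(⟨1, 0, 0, 0⟩ : ℍ[ℚ,-2,-5]), ⟨0, 1, 0, 0⟩, ⟨1/2, 1/2, 1/2, 0⟩, ⟨-1/2, 1/4, 0, 1/4⟩])))] [DecidableEq (ClassSet (Submodule.span ℤ (Set.range ![(⟨1, 0, 0, 0⟩ : ℍ[ℚ,-2,-5]), ⟨0, 1, 0, 0⟩, ⟨1/2, 1/2, 1/2, 0⟩, ⟨-1/2, 1/4, 0, 1/4⟩])))] :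
    matrix (Submodule.span ℤ (Set.range ![(⟨1, 0, 0, 0⟩ : ℍ[ℚ,-2,-5]), ⟨0, 1, 0, 0⟩, ⟨1/2, 1/2, 1/2, 0⟩, ⟨-1/2, 1/4, 0, 1/4⟩])) 2 * matrix (Submodule.span ℤ (Set.range ![(⟨1, 0, 0, 0⟩ : ℍ[ℚ,-2,-5]), ⟨0, 1, 0, 0⟩, ⟨1/2, 1/2, 1/2, 0⟩, ⟨-1/2, 1/4, 0, 1/4⟩])) 2 = matrix (Submodule.span ℤ (Set.range ![(⟨1, 0, 0, 0⟩ : ℍ[ℚ,-2,-5]), ⟨0, 1, 0, 0⟩, ⟨1/2, 1/2, 1/2, 0⟩, ⟨-1/2, 1/4, 0, 1/4⟩])) 4 + 2 • (1 : Matrix (ClassSet (Submodule.span ℤ (Set.range ![(⟨1, 0, 0, 0⟩ : ℍ[ℚ,-2,-5]), ⟨0, 1, 0, 0⟩, ⟨1/2, 1/2, 1/2, 0⟩, ⟨-1/2, 1/4, 0, 1/4⟩]))) (ClassSet (Submodule.span ℤ (Set.range ![(⟨1, 0, 0, 0⟩ : ℍ[ℚ,-2,-5]), ⟨0, 1, 0,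 0⟩, ⟨1/2, 1/2, 1/2, 0⟩, ⟨-1/2, 1/4, 0, 1/4⟩]))) ℤ) := by
  haveI := subsingleton_classSet
  ext i j
  rw [mul_apply₅, Matrix.add_apply, Matrix.smul_apply, Subsingleton.elim j i, Matrix.one_apply_eq, matrix_two, matrix_four]
  norm_num

/-- **EICHLER'S RECURSION (19) AT `p = 2`, `(μ, ν) = (1, 2)`, FOR `O₅`: `B(2)B(4) = B(8) + 2·B(2)`** (`3·7 = 15 + 6`).
[cite: Eichler1973, Ch. II §6 Thm. 2 (19)] -/
theorem matrix_two_mul_matrix_four [Fintype (ClassSet (Submodule.span ℤ (Set.range ![(⟨1, 0, 0, 0⟩ : ℍ[ℚ,-2,-5]), ⟨0, 1, 0, 0⟩, ⟨1/2, 1/2, 1/2, 0⟩, ⟨-1/2, 1/4, 0, 1/4⟩])))] :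
    matrix (Submodule.span ℤ (Set.range ![(⟨1, 0, 0, 0⟩ : ℍ[ℚ,-2,-5]), ⟨0, 1, 0, 0⟩, ⟨1/2, 1/2, 1/2, 0⟩, ⟨-1/2, 1/4, 0, 1/4⟩])) 2 * matrix (Submodule.span ℤ (Set.range ![(⟨1, 0, 0, 0⟩ : ℍ[ℚ,-2,-5]), ⟨0, 1, 0, 0⟩, ⟨1/2, 1/2, 1/2, 0⟩, ⟨-1/2, 1/4, 0, 1/4⟩])) 4 = matrix (Submodule.span ℤ (Set.range ![(⟨1, 0, 0, 0⟩ : ℍ[ℚ,-2,-5]), ⟨0, 1, 0, 0⟩, ⟨1/2, 1/2, 1/2, 0⟩, ⟨-1/2, 1/4, 0, 1/4⟩])) 8 + 2 • matrix (Submodule.span ℤ (Set.range ![(⟨1, 0, 0, 0⟩ : ℍ[ℚ,-2,-5]), ⟨0, 1, 0, 0⟩, ⟨1/2, 1/2, 1/2, 0⟩, ⟨-1/2, 1/4, 0, 1/4⟩])) 2 := by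
  haveI := subsingleton_classSet
  ext i j
  rw [mul_apply₅, Matrix.add_apply, Matrix.smul_apply, matrix_two, matrix_four, matrix_eight]
  norm_num

/-- **EICHLER'S RECURSION (19) AT `p = 2`, `(μ, ν) = (1, 3)`, FOR `O₅`: `B(2)B(8) = B(16) + 2·B(4)`** (`3·15 = 31 + 14`).
[cite: Eichler1973, Ch. II §6 Thm. 2 (19)] -/
theorem matrix_two_mul_matrix_eight [Fintype (ClassSet (Submodule.span ℤ (Set.range ![(⟨1, 0, 0, 0⟩ : ℍ[ℚ,-2,-5]), ⟨0, 1, 0, 0⟩, ⟨1/2, 1/2, 1/2, 0⟩, ⟨-1/2, 1/4, 0, 1/4⟩])))] :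
    matrix (Submodule.span ℤ (Set.range ![(⟨1, 0, 0, 0⟩ : ℍ[ℚ,-2,-5]), ⟨0, 1, 0, 0⟩, ⟨1/2, 1/2, 1/2, 0⟩, ⟨-1/2, 1/4, 0, 1/4⟩])) 2 * matrix (Submodule.span ℤ (Set.range ![(⟨1, 0, 0, 0⟩ : ℍ[ℚ,-2,-5]), ⟨0, 1, 0, 0⟩, ⟨1/2, 1/2, 1/2, 0⟩, ⟨-1/2, 1/4, 0, 1/4⟩])) 8 = matrix (Submodule.span ℤ (Set.range ![(⟨1, 0, 0, 0⟩ : ℍ[ℚ,-2,-5]), ⟨0, 1, 0, 0⟩, ⟨1/2, 1/2, 1/2, 0⟩, ⟨-1/2, 1/4, 0, 1/4⟩])) 16 + 2 • matrix (Submodule.span ℤ (Set.range ![(⟨1, 0, 0, 0⟩ : ℍ[ℚ,-2,-5]), ⟨0, 1, 0, 0⟩, ⟨1/2, 1/2, 1/2, 0⟩, ⟨-1/2, 1/4, 0, 1/4⟩])) 4 := by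
  haveI := subsingleton_classSet
  ext i j
  rw [mul_apply₅, Matrix.add_apply, Matrix.smul_apply, matrix_two, matrix_four, matrix_eight, matrix_sixteen]
  norm_num

/-- **EICHLER'S RECURSION (19) AT `p = 3`, `μ = ν = 1`, FOR `O₅`: `B(3)B(3) = B(9) + 3·B(1)`** (`4·4 = 13 + 3`).
[cite: Eichler1973, Ch. II §6 Thm. 2 (19)] -/
theorem matrix_three_mul_matrix_three [Fintype (ClassSet (Submodule.span ℤ (Set.range ![(⟨1, 0, 0, 0⟩ : ℍ[ℚ,-2,-5]), ⟨0, 1, 0, 0⟩, ⟨1/2, 1/2, 1/2, 0⟩, ⟨-1/2, 1/4, 0, 1/4⟩])))] [DecidableEq (ClassSet (Submodule.span ℤ (Set.range ![(⟨1, 0, 0, 0⟩ : ℍ[ℚ,-2,-5]), ⟨0, 1, 0, 0⟩, ⟨1/2, 1/2, 1/2, 0⟩, ⟨-1/2, 1/4, 0, 1/4⟩])))] :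
    matrix (Submodule.span ℤ (Set.range ![(⟨1, 0, 0, 0⟩ : ℍ[ℚ,-2,-5]), ⟨0, 1, 0, 0⟩, ⟨1/2, 1/2, 1/2, 0⟩, ⟨-1/2, 1/4, 0, 1/4⟩])) 3 * matrix (Submodule.span ℤ (Set.range ![(⟨1, 0, 0, 0⟩ : ℍ[ℚ,-2,-5]), ⟨0, 1, 0, 0⟩, ⟨1/2, 1/2, 1/2, 0⟩, ⟨-1/2, 1/4, 0, 1/4⟩])) 3 = matrix (Submodule.span ℤ (Set.range ![(⟨1, 0, 0, 0⟩ : ℍ[ℚ,-2,-5]), ⟨0, 1, 0, 0⟩, ⟨1/2, 1/2, 1/2, 0⟩, ⟨-1/2, 1/4, 0, 1/4⟩])) 9 + 3 • (1 : Matrix (ClassSet (Submodule.span ℤ (Set.range ![(⟨1, 0, 0, 0⟩ : ℍ[ℚ,-2,-5]), ⟨0, 1, 0, 0⟩, ⟨1/2, 1/2, 1/2, 0⟩, ⟨-1/2, 1/4, 0, 1/4⟩]))) (ClassSet (Submodule.span ℤ (Set.range ![(⟨1, 0, 0, 0⟩ : ℍ[ℚ,-2,-5]), ⟨0, 1, 0,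 0⟩, ⟨1/2, 1/2, 1/2, 0⟩, ⟨-1/2, 1/4, 0, 1/4⟩]))) ℤ) := by
  haveI := subsingleton_classSet
  ext i j
  rw [mul_apply₅, Matrix.add_apply, Matrix.smul_apply, Subsingleton.elim j i, Matrix.one_apply_eq, matrix_three, matrix_nine]
  norm_num

/-- `T(2ᵃ)_ij = σ(2ᵃ)` for `a ≤ 4` and `T(3ᵃ)_ij = σ(3ᵃ)` for `a ≤ 2` (Eichler Cor. 1: row sums `σ(n)` for `n` prime to `D`; here the
one-point class set). [cite: Eichler1973, Ch. II §6 Thm. 2 Cor. 1] -/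
theorem matrix_prime_pow_eq_sigma_small (i j : ClassSet (Submodule.span ℤ (Set.range ![(⟨1, 0, 0, 0⟩ : ℍ[ℚ,-2,-5]), ⟨0, 1, 0, 0⟩, ⟨1/2, 1/2, 1/2, 0⟩, ⟨-1/2, 1/4, 0, 1/4⟩]))) :
    (∀ {a : ℕ}, a ≤ 4 → matrix (Submodule.span ℤ (Set.range ![(⟨1, 0, 0, 0⟩ : ℍ[ℚ,-2,-5]), ⟨0, 1, 0, 0⟩, ⟨1/2, 1/2, 1/2, 0⟩, ⟨-1/2, 1/4, 0, 1/4⟩])) (2 ^ a) i j = ArithmeticFunction.sigma 1 (2 ^ a)) ∧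
      ∀ {a : ℕ}, a ≤ 2 → matrix (Submodule.span ℤ (Set.range ![(⟨1, 0, 0, 0⟩ : ℍ[ℚ,-2,-5]), ⟨0, 1, 0, 0⟩, ⟨1/2, 1/2, 1/2, 0⟩, ⟨-1/2, 1/4, 0, 1/4⟩])) (3 ^ a) i j = ArithmeticFunction.sigma 1 (3 ^ a) := by
  refine ⟨fun {a} ha => ?_, fun {a} ha => ?_⟩
  · interval_cases a
    · rw [pow_zero, matrix_one' i j, show ArithmeticFunction.sigma 1 1 = 1 by decide +kernel]
      norm_num
    · rw [pow_one, matrix_two, show ArithmeticFunction.sigma 1 2 = 3 by decide +kernel]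
      norm_num
    · rw [show (2 : ℕ) ^ 2 = 4 by norm_num, matrix_four, show ArithmeticFunction.sigma 1 4 = 7 by decide +kernel]
      norm_num
    · rw [show (2 : ℕ) ^ 3 = 8 by norm_num, matrix_eight, show ArithmeticFunction.sigma 1 8 = 15 by decide +kernel]
      norm_num
    · rw [show (2 : ℕ) ^ 4 = 16 by norm_num, matrix_sixteen, show ArithmeticFunction.sigma 1 16 = 31 by decide +kernel]
      norm_num
  · interval_cases a
    · rw [pow_zero, matrix_one' i j, show ArithmeticFunction.sigma 1 1 = 1 by decide +kernel]
      norm_num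
    · rw [pow_one, matrix_three, show ArithmeticFunction.sigma 1 3 = 4 by decide +kernel]
      norm_num
    · rw [show (3 : ℕ) ^ 2 = 9 by norm_num, matrix_nine, show ArithmeticFunction.sigma 1 9 = 13 by decide +kernel]
      norm_num

end Hecke

/-! ## §2 Every Brandt setup of type `(1, 5)` -/

section Setup

/-- **The definite quaternion algebra over `ℚ` of discriminant `5` is `(−2,−5 ∣ ℚ)`**: the algebra of every Brandt setup of
type `(1, 5)` is isomorphic to `ℍ[ℚ,−2,−5]` (same finite ramification `{v ∣ 5}`, both ramified at `∞`).
[cite: VignerasLNM800, Ch. III §3 Thm. 3.1] [cite: Voight2021, Thm. 25.4.1 (D = 5)] -/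
theorem xiSetup_nonempty_algEquiv (S : XiSetup 1 5) : Nonempty (S.D ≃ₐ[ℚ] ℍ[ℚ,-2,-5]) := by
  haveI := isQuaternionAlgebra
  have hf : ramifiedPlaces ℚ S.D = ramifiedPlaces ℚ ℍ[ℚ,-2,-5] := by
    rw [ramifiedPlaces_eq, S.ramifiedPlaces_eq]
  have hi : ramifiedInfinitePlaces ℚ S.D = ramifiedInfinitePlaces ℚ ℍ[ℚ,-2,-5] := by
    ext w
    simp only [mem_ramifiedInfinitePlaces_iff]
    exact ⟨fun _ => isTotallyDefinite w, fun _ => S.isTotallyDefinite w⟩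
  exact nonempty_algEquiv_of_ramifiedPlaces_eq_holds ℚ S.D ℍ[ℚ,-2,-5] hf hi

/-- The transport: class set, weights and Brandt matrices of `S.O` correspond to those of `O₅` (the type-`(1, 5)` instance of
`Brandt.XiSetup.exists_classSetEquiv`: along `ℍ[ℚ,−2,−5] ≃ S.D` and a connecting ideal between the two Eichler orders of
level `1`). [cite: VignerasLNM800, Ch. III §5 Cor. 5.5 and §5 B] -/
private theorem exists_classSetEquiv_xiSetup (S : XiSetup 1 5) :
    ∃ ε : ClassSet (Submodule.span ℤ (Set.range ![(⟨1, 0, 0, 0⟩ : ℍ[ℚ,-2,-5]), ⟨0, 1, 0, 0⟩, ⟨1/2, 1/2, 1/2, 0⟩, ⟨-1/2, 1/4, 0, 1/4⟩])) ≃ ClassSet S.O, (∀ c, weight S.O (ε c) = weight (Submodule.span ℤ (Set.range ![(⟨1, 0, 0, 0⟩ : ℍ[ℚ,-2,-5]), ⟨0, 1, 0, 0⟩, ⟨1/2, 1/2, 1/2, 0⟩, ⟨-1/2, 1/4, 0, 1/4⟩])) c) ∧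
      ∀ n c d, Brandt.matrix S.O n (ε c) (ε d) = Brandt.matrix (Submodule.span ℤ (Set.range ![(⟨1, 0, 0, 0⟩ : ℍ[ℚ,-2,-5]), ⟨0, 1, 0, 0⟩, ⟨1/2, 1/2, 1/2, 0⟩, ⟨-1/2, 1/4, 0, 1/4⟩])) n c d := by
  haveI := isQuaternionAlgebra
  obtain ⟨e'⟩ := xiSetup_nonempty_algEquiv S
  have e : ℍ[ℚ,-2,-5] ≃+* S.D := e'.symm.toRingEquiv
  obtain ⟨ε₁, -, hw₁, hT₁⟩ := exists_classSetEquiv_map_ringEquiv e (Submodule.span ℤ (Set.range ![(⟨1, 0, 0, 0⟩ : ℍ[ℚ,-2,-5]), ⟨0, 1, 0, 0⟩, ⟨1/2, 1/2, 1/2, 0⟩, ⟨-1/2, 1/4, 0, 1/4⟩]))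
  have hdiv : ∀ y : S.D, y ≠ 0 → IsUnit y := fun y hy =>
    isUnit_of_isTotallyDefinite S.D S.isTotallyDefinite hy
  have hO₁ : Brandt.IsEichlerOrder S.D (((Submodule.span ℤ (Set.range ![(⟨1, 0, 0, 0⟩ : ℍ[ℚ,-2,-5]), ⟨0, 1, 0, 0⟩, ⟨1/2, 1/2, 1/2, 0⟩, ⟨-1/2, 1/4, 0, 1/4⟩]))).map (e.toAddEquiv.toIntLinearEquiv : ℍ[ℚ,-2,-5] →ₗ[ℤ] S.D)) 1 :=
    brandt_isEichlerOrder_one_lattice.map_ringEquiv e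
  obtain ⟨I, hI, hIO⟩ := (isEichlerOrder_iff_brandt.mpr hO₁).exists_isInvertibleRightIdeal_leftOrderOf_eq
    hdiv (isEichlerOrder_iff_brandt.mpr S.isEichlerOrder) one_ne_zero
  have hImem : I ∈ Brandt.rightIdeals (((Submodule.span ℤ (Set.range ![(⟨1, 0, 0, 0⟩ : ℍ[ℚ,-2,-5]), ⟨0, 1, 0, 0⟩, ⟨1/2, 1/2, 1/2, 0⟩, ⟨-1/2, 1/4, 0, 1/4⟩]))).map (e.toAddEquiv.toIntLinearEquiv : ℍ[ℚ,-2,-5] →ₗ[ℤ] S.D)) := by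
    rw [rightIdeals_eq_invertibleRightIdeals_of_isTotallyDefinite S.isTotallyDefinite
      (isZOrder_iff_isOrder.mpr hO₁.isOrder)]
    exact hI
  have hIO' : Brandt.leftOrder I = S.O := hIO
  obtain ⟨ε₂, hw₂, hT₂⟩ :
      ∃ ε₂ : ClassSet (((Submodule.span ℤ (Set.range ![(⟨1, 0, 0, 0⟩ : ℍ[ℚ,-2,-5]), ⟨0, 1, 0, 0⟩, ⟨1/2, 1/2, 1/2, 0⟩, ⟨-1/2, 1/4, 0, 1/4⟩]))).map (e.toAddEquiv.toIntLinearEquiv : ℍ[ℚ,-2,-5] →ₗ[ℤ] S.D)) ≃ ClassSet S.O,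
        (∀ c, weight S.O (ε₂ c) = weight (((Submodule.span ℤ (Set.range ![(⟨1, 0, 0, 0⟩ : ℍ[ℚ,-2,-5]), ⟨0, 1, 0, 0⟩, ⟨1/2, 1/2, 1/2, 0⟩, ⟨-1/2, 1/4, 0, 1/4⟩]))).map (e.toAddEquiv.toIntLinearEquiv : ℍ[ℚ,-2,-5] →ₗ[ℤ] S.D)) c) ∧
        ∀ n c d, Brandt.matrix S.O n (ε₂ c) (ε₂ d) =
          Brandt.matrix (((Submodule.span ℤ (Set.range ![(⟨1, 0, 0, 0⟩ : ℍ[ℚ,-2,-5]), ⟨0, 1, 0, 0⟩, ⟨1/2, 1/2, 1/2, 0⟩, ⟨-1/2, 1/4, 0, 1/4⟩]))).map (e.toAddEquiv.toIntLinearEquiv : ℍ[ℚ,-2,-5] →ₗ[ℤ] S.D)) n c d := by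
    rw [← hIO']
    exact exists_classSetEquiv_leftOrder S.isTotallyDefinite hO₁.isOrder hImem
  exact ⟨ε₁.trans ε₂, fun c => by rw [Equiv.trans_apply, hw₂, hw₁],
    fun n c d => by rw [Equiv.trans_apply, Equiv.trans_apply, hT₂, hT₁]⟩

/-- **`h(5, 1) = 1`: the class set of every maximal order of the definite quaternion algebra of discriminant `5` is a point**
(Voight Thm. 25.4.1 at `D = 5`). [cite: Voight2021, Thm. 25.4.1 (D = 5) and Exercise 17.10 (a)] -/
theorem xiSetup_natCard_classSet (S : XiSetup 1 5) : Nat.card (ClassSet S.O) = 1 := by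
  obtain ⟨ε, -, -⟩ := exists_classSetEquiv_xiSetup S
  rw [← Nat.card_congr ε]
  exact card_classSet

/-- `Cls S.O` has at most one element. [cite: Voight2021, Thm. 25.4.1 (D = 5)] -/
theorem xiSetup_subsingleton_classSet (S : XiSetup 1 5) : Subsingleton (ClassSet S.O) :=
  (Nat.card_eq_one_iff_unique.mp (xiSetup_natCard_classSet S)).1

/-- `Cls S.O` is nonempty. [cite: Voight2021, Thm. 25.4.1 (D = 5)] -/
theorem xiSetup_nonempty_classSet (S : XiSetup 1 5) : Nonempty (ClassSet S.O) :=
  (Nat.card_eq_one_iff_unique.mp (xiSetup_natCard_classSet S)).2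

/-- `# Cls S.O = 1` for any `Fintype` structure on the class set. [cite: Voight2021, Thm. 25.4.1 (D = 5)] -/
theorem xiSetup_card_classSet (S : XiSetup 1 5) [Fintype (ClassSet S.O)] : Fintype.card (ClassSet S.O) = 1 := by
  rw [← Nat.card_eq_fintype_card]
  exact xiSetup_natCard_classSet S

/-- **Every Brandt weight of a setup of type `(1, 5)` is `w = [O_L(I)^× : ℤ^×] = 3`.** [cite: Voight2021, Thm. 25.1.1 and Thm. 11.5.14] -/
theorem xiSetup_weight (S : XiSetup 1 5) (c : ClassSet S.O) : weight S.O c = 3 := by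
  obtain ⟨ε, hw, -⟩ := exists_classSetEquiv_xiSetup S
  rw [← ε.apply_symm_apply c, hw, weight_eq_three]

/-- **EICHLER'S MASS FORMULA AT `(D, N) = (5, 1)`: `Σ_{[J] ∈ Cls O} 1/w_J = φ(5)/12 = 1/3`** for every maximal order of the
definite quaternion algebra of discriminant `5`. [cite: Voight2021, Thm. 25.1.1] [cite: VignerasLNM800, Ch. V §2 Cor. 2.3] -/
theorem xiSetup_sum_inv_weight (S : XiSetup 1 5) [Fintype (ClassSet S.O)] :
    ∑ c, (1 : ℚ) / weight S.O c = 1 / 3 := by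
  haveI := xiSetup_subsingleton_classSet S
  obtain ⟨c₀⟩ := xiSetup_nonempty_classSet S
  rw [Fintype.sum_subsingleton _ c₀, xiSetup_weight]
  norm_num

/-- **`T(p)_ij = p + 1` for every prime `p ≠ 5`, for every setup of type `(1, 5)`.** [cite: Eichler1973, Ch. II §6 (16)] [cite: Voight2021, Exercise 11.14 (c)] -/
theorem xiSetup_matrix_prime (S : XiSetup 1 5) {p : ℕ} (hp : p.Prime) (hp5 : p ≠ 5) (i j : ClassSet S.O) :
    Brandt.matrix S.O p i j = p + 1 := by
  obtain ⟨ε, -, hT⟩ := exists_classSetEquiv_xiSetup S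
  rw [← ε.apply_symm_apply i, ← ε.apply_symm_apply j, hT, matrix_prime hp hp5]

/-- **`T(5ᵃ)_ij = 1` for every setup of type `(1, 5)`** (the ramified prime). [cite: Eichler1973, Ch. II §6 Thm. 2 (20)] [cite: VignerasLNM800, Ch. III §5 exercice 5.8 (b)] -/
theorem xiSetup_matrix_five_pow (S : XiSetup 1 5) (a : ℕ) (i j : ClassSet S.O) : Brandt.matrix S.O (5 ^ a) i j = 1 := by
  obtain ⟨ε, -, hT⟩ := exists_classSetEquiv_xiSetup S
  rw [← ε.apply_symm_apply i, ← ε.apply_symm_apply j, hT, matrix_five_pow]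

/-- `T(5)_ij = 1` for every setup of type `(1, 5)`. [cite: Eichler1973, Ch. II §6 Thm. 2 (20)] -/
theorem xiSetup_matrix_five (S : XiSetup 1 5) (i j : ClassSet S.O) : Brandt.matrix S.O 5 i j = 1 := by
  obtain ⟨ε, -, hT⟩ := exists_classSetEquiv_xiSetup S
  rw [← ε.apply_symm_apply i, ← ε.apply_symm_apply j, hT, matrix_five]

/-- `T(1)_ij = 1` for every setup of type `(1, 5)`. [cite: Voight2021, 41.1.1] -/
theorem xiSetup_matrix_one (S : XiSetup 1 5) (i j : ClassSet S.O) : Brandt.matrix S.O 1 i j = 1 := by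
  obtain ⟨ε, -, hT⟩ := exists_classSetEquiv_xiSetup S
  rw [← ε.apply_symm_apply i, ← ε.apply_symm_apply j, hT, matrix_one']

/-- **`T(5ᵃm)_ij = σ(m)` for squarefree `m` prime to `5`, for every setup of type `(1, 5)`** (Eichler's Cor. 1: row sums).
[cite: Eichler1973, Ch. II §6 Thm. 2 (18), (20) and Cor. 1] -/
theorem xiSetup_matrix_apply_of_squarefree (S : XiSetup 1 5) (a : ℕ) {m : ℕ} (hm : Squarefree m) (h5 : ¬ 5 ∣ m)
    (i j : ClassSet S.O) : Brandt.matrix S.O (5 ^ a * m) i j = ArithmeticFunction.sigma 1 m := by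
  obtain ⟨ε, -, hT⟩ := exists_classSetEquiv_xiSetup S
  rw [← ε.apply_symm_apply i, ← ε.apply_symm_apply j, hT, matrix_apply_five_pow_mul_of_squarefree a hm h5]

end Setup

/-! ## §3 Every Eichler package of level `(1, 5)` -/

section Package

/-- **`h = 1` for every Eichler package of level `(1, 5)`** (`Nat.card` of the index type of its Brandt data). [cite: Voight2021, Thm. 25.4.1 (D = 5)] [cite: Pizer1980, §2] -/
theorem eichlerPackage_natCard_ι (P : EichlerPackage 1 5) : Nat.card P.brandtData.ι = 1 := by
  have hO : IsZOrder P.O := P.isEichlerOrder.isZOrder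
  have h := rightIdeals_eq_invertibleRightIdeals_of_isTotallyDefinite P.isTotallyDefinite hO
  rw [EichlerPackage.brandtData_ι, ← Nat.card_congr (ClassSet.equivRightIdealClass h)]
  exact xiSetup_natCard_classSet (P.toXiSetup Nat.prime_five.prime.squarefree)

/-- **The class number of every Eichler package of level `(1, 5)` is `1`.** [cite: Voight2021, Thm. 25.4.1 (D = 5)] [cite: Pizer1980, §2] -/
theorem eichlerPackage_classNumber (P : EichlerPackage 1 5) : P.brandtData.classNumber = 1 := by
  rw [BrandtData.classNumber, ← Nat.card_eq_fintype_card]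
  exact eichlerPackage_natCard_ι P

/-- The index type of the Brandt data of a package of level `(1, 5)` has at most one element. [cite: Voight2021, Thm. 25.4.1 (D = 5)] -/
theorem eichlerPackage_subsingleton_ι (P : EichlerPackage 1 5) : Subsingleton P.brandtData.ι :=
  (Nat.card_eq_one_iff_unique.mp (eichlerPackage_natCard_ι P)).1

/-- The index type of the Brandt data of a package of level `(1, 5)` is nonempty. [cite: Voight2021, Thm. 25.4.1 (D = 5)] -/
theorem eichlerPackage_nonempty_ι (P : EichlerPackage 1 5) : Nonempty P.brandtData.ι :=
  (Nat.card_eq_one_iff_unique.mp (eichlerPackage_natCard_ι P)).2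

/-- **`w_i = |O_L(I_i)^×|/2 = 3` for every Eichler package of level `(1, 5)`.** [cite: Voight2021, Thm. 25.1.1 and Thm. 11.5.14] -/
theorem eichlerPackage_w (P : EichlerPackage 1 5) (i : P.brandtData.ι) : P.brandtData.w i = 3 := by
  have hO : IsZOrder P.O := P.isEichlerOrder.isZOrder
  have h := rightIdeals_eq_invertibleRightIdeals_of_isTotallyDefinite P.isTotallyDefinite hO
  have key := BrandtData.ofOrder_w_equivRightIdealClass hO h ((ClassSet.equivRightIdealClass h).symm i)
  rw [Equiv.apply_symm_apply] at key
  exact key.trans (xiSetup_weight (P.toXiSetup Nat.prime_five.prime.squarefree) _)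

/-- `Σ_i 1/w_i = 1/3` for every Eichler package of level `(1, 5)`. [cite: Voight2021, Thm. 25.1.1] [cite: VignerasLNM800, Ch. V §2 Cor. 2.3] -/
theorem eichlerPackage_sum_inv_w (P : EichlerPackage 1 5) : ∑ i, (1 : ℚ) / P.brandtData.w i = 1 / 3 := by
  haveI := eichlerPackage_subsingleton_ι P
  obtain ⟨i₀⟩ := eichlerPackage_nonempty_ι P
  rw [Fintype.sum_subsingleton _ i₀, eichlerPackage_w]
  norm_num

/-- **EICHLER'S MASS FORMULA AT LEVEL `(N⁺, N⁻) = (1, 5)` — the clause `N⁺ = 1`, `N⁻ = 5` of the tree's named fact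
`brandtModule_massFormula`, unconditionally**: for every Eichler package `P` of level `(1, 5)`,
`Σ_i 1/w_i = (1/12) · ∏_{q ∣ 5}(q − 1) · ∏_{p^k ∥ 1} p^{k−1}(p + 1)` (`= 4/12 = 1/3`). [cite: VignerasLNM800, Ch. V §2 Cor. 2.3 (formule de masse d'Eichler)] [cite: Voight2021, Thm. 25.1.1] -/
theorem eichlerPackage_massFormula (P : EichlerPackage 1 5) :
    ∑ i : P.brandtData.ι, (1 : ℚ) / P.brandtData.w i =
      (1 / 12 : ℚ) * (∏ q ∈ (5 : ℕ).primeFactors, ((q : ℚ) - 1)) *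
        ∏ p ∈ (1 : ℕ).primeFactors, (p : ℚ) ^ ((1 : ℕ).factorization p - 1) * ((p : ℚ) + 1) := by
  rw [eichlerPackage_sum_inv_w, Nat.primeFactors_one, Nat.Prime.primeFactors Nat.prime_five, prod_empty,
    prod_singleton]
  norm_num

/-- **`B(p)_ij = p + 1` for primes `p ≠ 5`, for every Eichler package of level `(1, 5)`.** [cite: Eichler1973, Ch. II §6 (16)] [cite: Pizer1980, §2] -/
theorem eichlerPackage_T_prime (P : EichlerPackage 1 5) {p : ℕ} (hp : p.Prime) (hp5 : p ≠ 5) (i j : P.brandtData.ι) :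
    P.brandtData.T p i j = p + 1 := by
  have hO : IsZOrder P.O := P.isEichlerOrder.isZOrder
  have h := rightIdeals_eq_invertibleRightIdeals_of_isTotallyDefinite P.isTotallyDefinite hO
  have key := BrandtData.ofOrder_T_equivRightIdealClass hO h p ((ClassSet.equivRightIdealClass h).symm i)
    ((ClassSet.equivRightIdealClass h).symm j)
  rw [Equiv.apply_symm_apply, Equiv.apply_symm_apply] at key
  exact key.trans (xiSetup_matrix_prime (P.toXiSetup Nat.prime_five.prime.squarefree) hp hp5 _ _)

/-- **`B(5ᵃ)_ij = 1` for every Eichler package of level `(1, 5)`.** [cite: Eichler1973, Ch. II §6 Thm. 2 (20)] [cite: Pizer1980, §2] -/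
theorem eichlerPackage_T_five_pow (P : EichlerPackage 1 5) (a : ℕ) (i j : P.brandtData.ι) : P.brandtData.T (5 ^ a) i j = 1 := by
  have hO : IsZOrder P.O := P.isEichlerOrder.isZOrder
  have h := rightIdeals_eq_invertibleRightIdeals_of_isTotallyDefinite P.isTotallyDefinite hO
  have key := BrandtData.ofOrder_T_equivRightIdealClass hO h (5 ^ a) ((ClassSet.equivRightIdealClass h).symm i)
    ((ClassSet.equivRightIdealClass h).symm j)
  rw [Equiv.apply_symm_apply, Equiv.apply_symm_apply] at key
  exact key.trans (xiSetup_matrix_five_pow (P.toXiSetup Nat.prime_five.prime.squarefree) a _ _)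

/-- `B(5)_ij = 1` for every Eichler package of level `(1, 5)`. [cite: Eichler1973, Ch. II §6 Thm. 2 (20)] -/
theorem eichlerPackage_T_five (P : EichlerPackage 1 5) (i j : P.brandtData.ι) : P.brandtData.T 5 i j = 1 := by
  have h := eichlerPackage_T_five_pow P 1 i j
  rwa [pow_one] at h

end Package

/-! ## §4 The chosen Brandt data `brandtModule 1 5` -/

section Module

/-- **An explicit Eichler package of level `(1, 5)`: `(ℍ[ℚ,−2,−5], O₅)`** (so `brandtModule 1 5` is not the junk value).
[cite: Voight2021, Exercise 17.10 and Thm. 25.4.1 (D = 5)] -/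
theorem nonempty_eichlerPackage_one_five : Nonempty (EichlerPackage 1 5) :=
  haveI := isQuaternionAlgebra
  ⟨{ B := ℍ[ℚ,-2,-5]
     instIsQuaternionAlgebra := isQuaternionAlgebra
     isTotallyDefinite := isTotallyDefinite
     mem_ramifiedPlaces_iff := mem_ramifiedPlaces_iff_five_mem
     O := (Submodule.span ℤ (Set.range ![(⟨1, 0, 0, 0⟩ : ℍ[ℚ,-2,-5]), ⟨0, 1, 0, 0⟩, ⟨1/2, 1/2, 1/2, 0⟩, ⟨-1/2, 1/4, 0, 1/4⟩]))
     isEichlerOrder := isEichlerOrder_one_lattice }⟩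

/-- **The class number of `brandtModule 1 5` is `1`.** [cite: Voight2021, Thm. 25.4.1 (D = 5)] [cite: Pizer1980, §2] -/
theorem brandtModule_one_five_classNumber : (brandtModule 1 5).classNumber = 1 := by
  rw [brandtModule_eq nonempty_eichlerPackage_one_five]
  exact eichlerPackage_classNumber _

/-- **The weights of `brandtModule 1 5` are `3`.** [cite: Voight2021, Thm. 25.1.1 and Thm. 11.5.14] -/
theorem brandtModule_one_five_w (i : (brandtModule 1 5).ι) : (brandtModule 1 5).w i = 3 := by
  have key : ∀ M : BrandtData.{0}, M = (brandtPackage 1 5 nonempty_eichlerPackage_one_five).brandtData →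
      ∀ i : M.ι, M.w i = 3 := by
    rintro M rfl i
    exact eichlerPackage_w _ i
  exact key _ (brandtModule_eq _) i

/-- `Σ_i 1/w_i = 1/3` for `brandtModule 1 5` (Eichler's mass formula at `(1, 5)`). [cite: Voight2021, Thm. 25.1.1] [cite: VignerasLNM800, Ch. V §2 Cor. 2.3] -/
theorem brandtModule_one_five_sum_inv_w : ∑ i, (1 : ℚ) / (brandtModule 1 5).w i = 1 / 3 := by
  have key : ∀ M : BrandtData.{0}, M = (brandtPackage 1 5 nonempty_eichlerPackage_one_five).brandtData →
      ∑ i, (1 : ℚ) / M.w i = 1 / 3 := by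
    rintro M rfl
    exact eichlerPackage_sum_inv_w _
  exact key _ (brandtModule_eq _)

/-- **`B(p)_ij = p + 1` (`p ≠ 5` prime) for `brandtModule 1 5`.** [cite: Eichler1973, Ch. II §6 (16)] [cite: Pizer1980, §2] -/
theorem brandtModule_one_five_T_prime {p : ℕ} (hp : p.Prime) (hp5 : p ≠ 5) (i j : (brandtModule 1 5).ι) :
    (brandtModule 1 5).T p i j = p + 1 := by
  have key : ∀ M : BrandtData.{0}, M = (brandtPackage 1 5 nonempty_eichlerPackage_one_five).brandtData →
      ∀ i j : M.ι, M.T p i j = p + 1 := by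
    rintro M rfl i j
    exact eichlerPackage_T_prime _ hp hp5 i j
  exact key _ (brandtModule_eq _) i j

/-- **`B(5ᵃ)_ij = 1` for `brandtModule 1 5`.** [cite: Eichler1973, Ch. II §6 Thm. 2 (20)] [cite: Pizer1980, §2] -/
theorem brandtModule_one_five_T_five_pow (a : ℕ) (i j : (brandtModule 1 5).ι) : (brandtModule 1 5).T (5 ^ a) i j = 1 := by
  have key : ∀ M : BrandtData.{0}, M = (brandtPackage 1 5 nonempty_eichlerPackage_one_five).brandtData →
      ∀ i j : M.ι, M.T (5 ^ a) i j = 1 := by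
    rintro M rfl i j
    exact eichlerPackage_T_five_pow _ a i j
  exact key _ (brandtModule_eq _) i j

end Module

end Literature.NumberTheory.Automorphic.MaxOrderDiscFive
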